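import Summits.CriticalPhenomena.Ising3D.IsingColumnFaceL11CensusDistinctPart

/-!
# The catalogue census of §7.3 as kernel facts, IX: the distinct-values machine — kernel evaluations, window 6 of 8, file B
(cell `pub-ising3x`, seat recog-1; paper §1.6 / §7.3)

HONEST FRAMING: lottery ticket; floor = tightest certified 3D Ising CFT bounds; no exact-solution
claim without a proof. Island framing: certified exclusion region at stated derivative order and
assumptions; not a determination of the 3D Ising critical exponents beyond that.

TWO `decide +kernel` evaluations on the scaled window `[194294980410553963552485659385600, 196619877627710596447514340614400]` (units `distU = 10¹⁸·lcm(1..32)`; values `[2691/2000 − dT, 851/625 + dT]` of `Δε`, neighbouring windows overlapping by `dT`): `crossPartChk (clsGroup 1)` and `crossPartChk (clsGroup 2)` — the non-form `LIN` tuples of the classes {1, 5} resp. {2, 3, 4} merged with the 4820 canonical lowest-terms `TRG` tuples of the window, chains `dL` and `dX` in one pass each.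
Each evaluation consumes every generated list exactly once and stays under the farm's per-check heap budget (≈ 1–2 min of kernel
time each; one evaluation of the whole window does not fit — recog-1 gen 53 TIMINGS.md); long, not deep (`maxHeartbeats` as in the
cell's certificate files). Assembled over the eight windows in `…DistinctAssembly.lean`. Python twin (same integers, same
chains, PASS): recog-1 gen 53 `parts.py` / `parts8.json`.
lottery ticket; floor = tightest certified 3D Ising CFT bounds; no exact-solution claim without a proof.
-/

namespace Summit.CriticalPhenomena.Ising3D
namespace ColumnFaceL11

set_option maxHeartbeats 200000000 in
set_option maxRecDepth 200000 in
/-- **Window 6 of 8, mixed, class group 1** (`LIN` classes {1, 5} against `TRG`). [folklore] -/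
theorem crossPart_6_1 : crossPartChk (clsGroup 1) 194294980410553963552485659385600 196619877627710596447514340614400 = true := by
  decide +kernel

set_option maxHeartbeats 200000000 in
set_option maxRecDepth 200000 in
/-- **Window 6 of 8, mixed, class group 2** (`LIN` classes {2, 3, 4} against `TRG`). [folklore] -/
theorem crossPart_6_2 : crossPartChk (clsGroup 2) 194294980410553963552485659385600 196619877627710596447514340614400 = true := by
  decide +kernel

end ColumnFaceL11
end Summit.CriticalPhenomena.Ising3D
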